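import Summits.QuantumFields.YangMills.Theorems.BalabanLadderROTWardShapeCubic
import Summits.QuantumFields.YangMills.Theorems.LangevinControlUVOSLegsFromFemtoAndGapStubAssemblyDensityExpansion
import HarnessLib

/-!
# Crux `ROT` (stmt-QuantumFields-20042), infinitesimal Ward route (lane B) — XII: the barrier for the PLANE-RESOLVED binder `MomentBounds6`

Helper file (`--supports stmt-QuantumFields-20042`, lane `ym-rot-20042-p2`).  The registered stub carries `MomentBounds6 G r a` (bounds for
every string of plaquette orientations), which implies `MomentBounds` (tree `momentBounds_of_momentBounds6`) but is formally finer.  This file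
transcribes its text over an abstract plane-string weight family (`MomentBounds6Shape a W6`), records that the Yang–Mills plane-string
weights satisfy it definitionally (`momentBounds6Shape_of_momentBounds6`) and that their sum over the `6ⁿ` orientation strings is the
centred density weight tested by the Ward form (`planeSum_yangMills`, tree `torusMoment_dens_eq_sum_torusMomentStr`), and shows that the
hypercubic-invariant witness of `…WardShapeCubic.lean`, spread evenly over the orientation strings (`W6c`), satisfies `MomentBounds6Shape`
while its density weight violates `AngularWardShape`: **`exists_momentBounds6Shape_not_angularWardShape`**.

READING: the plane resolution of the UV binder does not change the verdict of files VII/XI — sizes of (mixed plane) moments, at any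
resolution, plus the lattice symmetries do not bound the breaking insertion's limit.  HONEST FRAMING: strategy barrier for an OPEN crux;
nothing about E1, a gap, or Clay.  No fact, no sorry.
-/

set_option autoImplicit false

noncomputable section

open scoped SchwartzMap BigOperators
open MeasureTheory Filter Topology Metric
open Literature.MathematicalPhysics.QuantumFieldTheory Literature.MathematicalPhysics.QuantumLattice
open Literature.MathematicalPhysics.AQFT
open Literature.Probability.LatticeModels (box Site)
open Summit.QuantumFields.YangMills.Theorems.OSLegsFromFemtoAndGap (torusMoment)
open Summit.QuantumFields.YangMills.Theorems.NPointIsotropy.Negative (E4)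

namespace Summit.QuantumFields.YangMills.Theorems.ROT.Ward

/-! ## The plane-resolved binder: `MomentBounds6`-shape does not help either -/

section PlaneResolved

open Summit.QuantumFields.YangMills.Cruxes.OSLegsFromFemtoAndGap.DlrCollarTransfer (MomentBounds6 plane torusE)

/-- **MomentBounds6-SHAPE** — the text of the crux's actual UV binder `MomentBounds6 G r a` (plane-resolved hyperscaling bounds for every
string of plaquette orientations `q` with `(q i).1 < (q i).2`) with the centred mixed plane moment replaced by an abstract plane-string weight
family `W6 β L n q x`.  `MomentBounds6 G r a` is literally `MomentBounds6Shape a (W6_YM r)` (`momentBounds6Shape_of_momentBounds6`). -/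
def MomentBounds6Shape (a : ℝ → ℝ) (W6 : ℝ → ℕ → (n : ℕ) → (Fin n → Fin 4 × Fin 4) → (Fin n → Site 4) → ℝ) : Prop :=
  ∃ (C β₄ ℓ₄ : ℝ), 0 < ℓ₄ ∧ 0 ≤ C ∧ ∀ β : ℝ, β₄ ≤ β →
    ∀ (L n : ℕ) (q : Fin n → Fin 4 × Fin 4) (x : Fin n → Site 4) (R : ℕ), (∀ i, (q i).1 < (q i).2) →
      1 ≤ R → (R : ℝ) * a β ≤ ℓ₄ → 4 * R + 8 ≤ L →
      (∀ i j : Fin n, i ≠ j → ∃ k : Fin 4,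
        (2 * (R : ℤ) + 4) ≤ |((((x i k - x j k : ℤ) : ZMod (2 * L + 1))).valMinAbs : ℤ)|) →
      |W6 β L n q x| ≤ (C / (R : ℝ) ^ 4) ^ n

/-- The density weight assembled from a plane-string weight family: the sum over the `6ⁿ` admissible orientation strings
(for Yang–Mills: `tr F² = Σ_p P^p`, tree `torusMoment_dens_eq_sum_torusMomentStr`). -/
def planeSum (W6 : ℝ → ℕ → (n : ℕ) → (Fin n → Fin 4 × Fin 4) → (Fin n → Site 4) → ℝ)
    (β : ℝ) (L : ℕ) (n : ℕ) (x : Fin n → Site 4) : ℝ :=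
  ∑ q ∈ Fintype.piFinset (fun _ : Fin n => Finset.univ.filter fun p : Fin 4 × Fin 4 => p.1 < p.2), W6 β L n q x

variable {G : Type} [Group G] [TopologicalSpace G] [IsTopologicalGroup G] [CompactSpace G]
  [MeasurableSpace G] [BorelSpace G]

/-- `MomentBounds6 G r a` IS the plane-resolved shape statement for the Yang–Mills plane-string weights. -/
theorem momentBounds6Shape_of_momentBounds6 (r : LatticeRep G) {a : ℝ → ℝ} (h : MomentBounds6 G r a) :
    MomentBounds6Shape a (fun β L _ q x =>
      torusE G r β L (fun U => ∏ i, (plane G r (q i) (x i) U - torusE G r β L (plane G r (q i) (x i))))) :=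
  h

/-- For the Yang–Mills weights, `planeSum` of the plane-string weights is the centred density weight that `LatticeAngularWard` tests
(tree `torusMoment_dens_eq_sum_torusMomentStr`). -/
theorem planeSum_yangMills (r : LatticeRep G) (β : ℝ) (L : ℕ) {n : ℕ} (x : Fin n → Site 4) :
    planeSum (fun β L _ q x =>
        torusE G r β L (fun U => ∏ i, (plane G r (q i) (x i) U - torusE G r β L (plane G r (q i) (x i))))) β L n x =
      torusMoment r.ρ β L r.curvature.F (wilsonTorusMean r.ρ β L r.curvature.F) x := by
  unfold planeSum
  rw [Summit.QuantumFields.YangMills.Theorems.OSLegsFromFemtoAndGap.torusMoment_dens_eq_sum_torusMomentStr]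
  refine Finset.sum_congr rfl fun q _ => ?_
  exact Summit.QuantumFields.YangMills.Theorems.OSLegsFromFemtoAndGap.torusE_prod_plane_eq_torusMomentStr r β L q x

/-- The plane-resolved witness: the cubic witness spread evenly over the `6ⁿ` orientation strings. -/
def W6c (β : ℝ) (L : ℕ) (n : ℕ) (_q : Fin n → Fin 4 × Fin 4) (x : Fin n → Site 4) : ℝ :=
  Wgen hcFun β L n x / 6 ^ n

/-- Its density weight is the cubic witness. -/
theorem planeSum_W6c : planeSum W6c = Wgen hcFun := by
  funext β L n x
  unfold planeSum W6c
  rw [Finset.sum_const, Fintype.card_piFinset, Finset.prod_const,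
    Summit.QuantumFields.YangMills.Theorems.OSLegsFromFemtoAndGap.card_planes, Finset.card_univ, Fintype.card_fin,
    nsmul_eq_mul]
  push_cast
  field_simp

/-- The plane-resolved witness obeys every MomentBounds6-shape inequality (`C = 2`). -/
theorem momentBounds6Shape_W6c : MomentBounds6Shape aW W6c := by
  obtain ⟨C, β₄, ℓ₄, hℓ, hC, H⟩ := momentBoundsShape_Wgen hcFun abs_hcFun_le (fun _ hz => hcFun_eq_zero_of_norm hz)
  refine ⟨C, β₄, ℓ₄, hℓ, hC, fun β hβ L n q x R _ hR hRa hRL hsep => ?_⟩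
  have h := H β hβ L n x R hR hRa hRL hsep
  unfold W6c
  rw [abs_div, abs_of_pos (by positivity : (0 : ℝ) < 6 ^ n)]
  refine (div_le_self (abs_nonneg _) ?_).trans h
  exact one_le_pow₀ (by norm_num)

/-- **SHAPE BARRIER for the plane-resolved binder.**  Even the crux's actual UV binder shape — `MomentBounds6`, bounds for every string of
plaquette orientations — does not force the Ward form: the witness `W6c` (hypercubic- and translation-invariant density weight) satisfies
`MomentBounds6Shape` and its density weight violates `AngularWardShape`.  With `momentBounds6Shape_of_momentBounds6` and
`planeSum_yangMills` this is exactly the shape of the registered stub's hypothesis versus its Ward-form conclusion. -/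
theorem exists_momentBounds6Shape_not_angularWardShape :
    ∃ (a : ℝ → ℝ) (W6 : ℝ → ℕ → (n : ℕ) → (Fin n → Fin 4 × Fin 4) → (Fin n → Site 4) → ℝ),
      (∀ β, 0 < a β) ∧ Tendsto a atTop (𝓝 0) ∧ MomentBounds6Shape a W6 ∧ ¬ AngularWardShape a (planeSum W6) :=
  ⟨aW, W6c, aW_pos, tendsto_aW, momentBounds6Shape_W6c, by rw [planeSum_W6c]; exact not_angularWardShape_Wgen_hcFun⟩

end PlaneResolved

end Summit.QuantumFields.YangMills.Theorems.ROT.Ward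

end
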